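import Literature.Analysis.FluidPDE.NSVorticityBKMHolds
import Literature.Analysis.FluidPDE.ClassicalNSBlowupAlternative
import HarnessLib

/-!
# The maximal solution in the Beale–Kato–Majda class, `ν ≥ 0` (Euler included): every closed slab,
# or a finite maximal time at which the `H³` norm and `∫₀ᵀ ‖curl u‖_∞` blow up

Analysis/FluidPDE **proofs file** (theorems only: no definitions, no named facts, no `sorry`). The
Beale–Kato–Majda-class twin (`ν ≥ 0`, Euler for `ν = 0`) of the finite-energy blow-up alternative
`finiteEnergy_classical_dichotomy` (`ClassicalNSBlowupAlternative.lean`, `ν > 0` only). The class is the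
one of the tree's `beale_kato_majda` (`NSVorticity.lean`): classical solutions of the unforced system on
`ℝ³`, jointly smooth on the slab, with the `L²` norms of ALL spatial Fréchet derivatives bounded
(`HasBoundedSobolevNormsOn`, i.e. `u ∈ L^∞_t H^n_x` for every `n` — Beale–Kato–Majda 1984, §1; Kato 1972;
Majda–Bertozzi 2002, §3.2, the `H^m` theory read for `H^∞ ∩ C^∞` data).

* `exists_bkmClass_Icc_extension` — **restart from a CLOSED slab** (Majda–Bertozzi 2002, the
  continuation process after (3.69), p. 112: "At time `T`, choose `v(x, T)` as initial data for a new
  solution and repeat the process"; Cor. 3.2): a classical solution on `[0, T] × ℝ³`, `T > 0`, `ν ≥ 0`, with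
  all Sobolev seminorms bounded on `[0, T]` extends to a classical solution on a LONGER closed slab
  `[0, T']`, `T' > T`, with all Sobolev seminorms bounded on `[0, T']` and the same initial slice. (The
  tree's `HasSobolevExtensionPast` records the bounds only up to `T`; here they are carried past `T`, which
  is what the maximal-time bookkeeping needs.) Proof: with `A` the squared `H³` size bound on `[0, T]` and
  `τ = τ(ν, A)` the lifespan of `MajdaBertozzi2002_localExistenceH3_holds`, restart at `s = max(0, T − τ/2)`
  from `u(s)`; the local solution `v` on `[0, τ]` equals `u(· + s)` on `[0, T − s]`
  (`MajdaBertozzi2002_uniquenessSobolev_holds`); glue `u|[0,T)` and `v(· − s)|(s, s + τ)` along the open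
  overlap `(s, T)` (`IsClassicalNSSolutionOn.glue`) and restrict to `[0, T + τ/4]`.
* `bkmClass_dichotomy` — **THE ALTERNATIVE** for `ν ≥ 0` and a smooth divergence-free datum with all
  derivatives in `L²`: EITHER every closed slab `[0, T]`, `T > 0`, carries a classical solution from `u₀` in
  the class, OR there are `T* > 0` and a classical solution `(u, p)` on the half-open slab `[0, T*) × ℝ³`
  from `u₀`, in the class on every `[0, T'']`, `T'' < T*`, whose squared `H³` size
  `Σ_{n ≤ 3} ∫‖Dⁿu(t)‖²` is UNBOUNDED on `[0, T*)`, which does NOT continue in the class past `T*`, whose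
  BKM integral `∫₀^{T*} sup_x |curl u| = ∞`, and such that NO closed slab `[0, T]`, `T ≥ T*`, carries a
  classical solution from `u₀` in the class (`T*` is the maximal time of `H^∞` existence) — Majda–Bertozzi
  2002, §3.3 before Thm. 3.6 ("`T` is the maximal time of the existence of smooth solutions … if and only if
  `lim_{t↗T} ‖v(·,t)‖_m = ∞`") with Thm. 3.6 / Beale–Kato–Majda 1984, Corollary ("`∫₀^{T*}|ω|_∞ = ∞` on the
  maximal interval").
* `exists_global_bkmClass_or_blowup` — the GLOBAL form: a classical solution on `[0, ∞) × ℝ³` from `u₀`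
  with all Sobolev seminorms bounded on every `[0, T]` (pressure normalised by `p(t, 0) = 0`), OR the second
  branch. The first branch is patched from the closed slabs by the tree's generic
  `IsClassicalNSSolutionOn.exists_Ici_of_forall_Icc_of_unique` with Majda–Bertozzi uniqueness.

## The proof (every input is a theorem of the tree)

Word for word the proof of `finiteEnergy_classical_dichotomy` with the finite-energy class replaced by the
BKM class: `𝒯` = horizons `T > 0` whose closed slab carries a class solution from `u₀`; an initial segment
(restriction), nonempty (`MajdaBertozzi2002_localExistenceH3_holds`), and — the one new point — OPEN TO THE
RIGHT (`exists_bkmClass_Icc_extension`), so that `T* := sup 𝒯 ∉ 𝒯` when `𝒯` is bounded. Class solutions on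
the slabs `[0, T*(n+1)/(n+2)]` agree at common times (`MajdaBertozzi2002_uniquenessSobolev_holds`) and glue
to a classical solution on `[0, T*)` (`IsClassicalNSSolutionOn.exists_glue_Ico_right`), in the class on
compact sub-slabs. If its `H³` size were bounded on `[0, T*)`, the tree's continuation principle
`hasSobolevExtensionPast_iff_exists_H3_bound` (Majda–Bertozzi Cor. 3.2, discharged) would continue it in the
class past `T*`; restricted to `[0, T*]` the continuation would put `T* ∈ 𝒯` — contradiction; the BKM
integral is then infinite by `lintegral_iSup_curl_eq_top_of_not_hasSobolevExtensionPast_holds`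
(Beale–Kato–Majda Thm. 1, discharged).

## Mathlib / tree search

Tree (`lean search`): `finiteEnergy_classical_dichotomy`, `exists_global_finiteEnergy_classical_or_supBlowup`
(`ν > 0`, finite energy; `ClassicalNSBlowupAlternative`); `clayR3_solvable_or_supBlowup` (Clay data,
`ClayR3BlowupAlternative`); `Torus.exists_maximal_classicalNS_lerayTime` (torus). Nothing for the BKM class /
`ν = 0`. Used: `MajdaBertozzi2002_localExistenceH3_holds` (`NSVorticityBKMLocalExistence`),
`MajdaBertozzi2002_uniquenessSobolev_holds` (`ClassicalSobolevUniqueness`),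
`hasSobolevExtensionPast_iff_exists_H3_bound`, `lintegral_iSup_curl_eq_top_of_not_hasSobolevExtensionPast_holds`
(`NSVorticityBKMHolds`), `IsClassicalNSSolutionOn.glue`, `.comp_add_right` (`ClassicalSolutionGlue`),
`.exists_glue_Ico_right` (`LerayHopfClassicalContinuation`), `.exists_Ici_of_forall_Icc_of_unique`
(`ClassicalNSHorizonPatching`), `HasBoundedSobolevNormsOn.mono` (`NSVorticity`).

## References

* A. J. Majda, A. L. Bertozzi, *Vorticity and Incompressible Flow*, CUP 2002: Thm. 3.4, the continuation
  process after (3.69) and Cor. 3.2 (p. 112), §3.3 and Thm. 3.6 (pp. 115–117). [MajdaBertozzi2002]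
* J. T. Beale, T. Kato, A. Majda, *Remarks on the breakdown of smooth solutions for the 3-D Euler
  equations*, Comm. Math. Phys. 94 (1984), 61–66: Thm. 1 and Corollary. [BealeKatoMajda1984]
* T. Kato, *Nonstationary flows of viscous and ideal fluids in `ℝ³`*, J. Funct. Anal. 9 (1972), 296–305.

WHAT THIS IS NOT: not a claim about NS regularity or blow-up; not a claim about any author beyond the
typed locator.
-/

noncomputable section

open MeasureTheory Set Function Filter Topology
open scoped ENNReal NNReal ContDiff

namespace Literature.Analysis.FluidPDE

variable {ν : ℝ} {u₀ : EuclideanSpace ℝ (Fin 3) → EuclideanSpace ℝ (Fin 3)}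

/-! ## Restart from a closed slab: the class is open to the right -/

/-- **Restart from a closed slab in the Beale–Kato–Majda class** (Majda–Bertozzi 2002, continuation
process after (3.69) and Cor. 3.2): for `ν ≥ 0` and `T > 0`, a classical unforced solution `(u, p)` on
`[0, T] × ℝ³` with all `L²` Sobolev seminorms bounded on `[0, T]` extends to a classical solution `(u', p')`
on a longer CLOSED slab `[0, T']`, `T' > T`, with all Sobolev seminorms bounded on `[0, T']` and
`u' 0 = u 0` (indeed `u' = u` before `T`). See the module docstring for the restart-and-glue proof from
`MajdaBertozzi2002_localExistenceH3_holds`, `MajdaBertozzi2002_uniquenessSobolev_holds` and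
`IsClassicalNSSolutionOn.glue`. [cite: MajdaBertozzi2002, continuation process after (3.69) and Cor. 3.2 (p. 112)] -/
theorem exists_bkmClass_Icc_extension (hν : 0 ≤ ν) {T : ℝ} (hT : 0 < T)
    {u : ℝ → EuclideanSpace ℝ (Fin 3) → EuclideanSpace ℝ (Fin 3)}
    {p : ℝ → EuclideanSpace ℝ (Fin 3) → ℝ}
    (hsol : IsClassicalNSSolutionOn (Icc 0 T) ν 0 u p) (hB : HasBoundedSobolevNormsOn (Icc 0 T) u) :
    ∃ T' : ℝ, T < T' ∧
      ∃ (u' : ℝ → EuclideanSpace ℝ (Fin 3) → EuclideanSpace ℝ (Fin 3))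
        (p' : ℝ → EuclideanSpace ℝ (Fin 3) → ℝ),
        IsClassicalNSSolutionOn (Icc 0 T') ν 0 u' p' ∧ HasBoundedSobolevNormsOn (Icc 0 T') u' ∧
          u' 0 = u 0 ∧ ∀ t ∈ Ico 0 T, u' t = u t := by
  classical
  -- the squared `H³` size bound `A` on `[0, T]`
  choose C hC using hB
  set A : ℝ≥0 := ∑ n ∈ Finset.range 4, C n with hA
  have hAbd : ∀ t ∈ Icc 0 T,
      (∑ n ∈ Finset.range 4, ∫⁻ x, ‖iteratedFDeriv ℝ n (u t) x‖ₑ ^ 2) ≤ (A : ℝ≥0∞) := by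
    intro t ht
    rw [hA]
    push_cast
    exact Finset.sum_le_sum fun n _ => hC n t ht
  -- the lifespan `τ = τ(ν, A)` and the restart time `s = max 0 (T - τ/2)`
  obtain ⟨τ, hτ, hLτ⟩ := MajdaBertozzi2002_localExistenceH3_holds hν A
  set s : ℝ := max 0 (T - τ / 2) with hs
  have hs0 : 0 ≤ s := le_max_left _ _
  have hsT : s < T := max_lt hT (by linarith)
  have hTs : T - s ≤ τ / 2 := by
    have : T - τ / 2 ≤ s := le_max_right _ _
    linarith
  have hsS : s ∈ Icc 0 T := ⟨hs0, hsT.le⟩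
  -- restart from the datum `u s`
  obtain ⟨v, q, hv, hv0, hvB⟩ := hLτ (hsol.contDiff_velocity hsS) (hsol.divFree s hsS)
    (fun n => (hC n s hsS).trans_lt ENNReal.coe_lt_top) (hAbd s hsS)
  -- uniqueness on the closed slab `[0, T - s]`: `u (· + s) = v`
  have huniq : ∀ t ∈ Icc 0 (T - s), u (t + s) = v t := by
    have hS0 : 0 < T - s := sub_pos.2 hsT
    have h1 : IsClassicalNSSolutionOn (Icc 0 (T - s)) ν 0 (fun r => u (r + s)) (fun r => p (r + s)) :=
      (hsol.comp_add_right s).mono (fun r hr => ⟨by linarith [hr.1], by linarith [hr.2]⟩)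
        (uniqueDiffOn_Icc hS0)
    have h2 : IsClassicalNSSolutionOn (Icc 0 (T - s)) ν 0 v q :=
      hv.mono (Icc_subset_Icc_right (by linarith)) (uniqueDiffOn_Icc hS0)
    have hB1 : HasBoundedSobolevNormsOn (Icc 0 (T - s)) (fun r => u (r + s)) := fun n =>
      ⟨C n, fun r hr => hC n (r + s) ⟨by linarith [hr.1], by linarith [hr.2]⟩⟩
    have hB2 : HasBoundedSobolevNormsOn (Icc 0 (T - s)) v := hvB.mono (Icc_subset_Icc_right (by linarith))
    have h0 : (fun r => u (r + s)) 0 = v 0 := by simp only [zero_add, hv0]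
    exact MajdaBertozzi2002_uniquenessSobolev_holds hν hS0 h1 h2 hB1 hB2 h0
  -- glue `u|[0,T)` and `v (· - s)|(s, s + τ)` along the open overlap `(s, T)`
  have h₁ : IsClassicalNSSolutionOn (Ico 0 T) ν 0 u p := hsol.mono Ico_subset_Icc_self (uniqueDiffOn_Ico 0 T)
  have h₂ : IsClassicalNSSolutionOn (Ioo s (s + τ)) ν 0 (fun t => v (t + -s)) (fun t => q (t + -s)) :=
    (hv.comp_add_right (-s)).mono (fun t ht => ⟨by linarith [ht.1], by linarith [ht.2]⟩)
      isOpen_Ioo.uniqueDiffOn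
  have heq : ∀ t ∈ Ioo s T, u t = v (t + -s) := by
    intro t ht
    have h := huniq (t + -s) ⟨by linarith [ht.1], by linarith [ht.2]⟩
    rw [show t + -s + s = t by ring] at h
    exact h
  have hTb : T ≤ s + τ := by linarith
  have hglue := h₁.glue h₂ hs0 hsT hTb heq
  -- the longer closed slab `[0, T + τ/4] ⊂ [0, s + τ)`
  set T' : ℝ := T + τ / 4 with hT'
  have hTT' : T < T' := by rw [hT']; linarith
  have hT'b : T' < s + τ := by rw [hT']; linarith
  have hT'0 : 0 < T' := hT.trans hTT'
  refine ⟨T', hTT', _, _, hglue.mono (Icc_subset_Ico_right hT'b) (uniqueDiffOn_Icc hT'0), ?_, ?_, ?_⟩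
  · -- Sobolev seminorms on `[0, T']`: those of `u` on `[0, T]` and of `v` on `[0, τ]`
    intro n
    obtain ⟨C₂, hC₂⟩ := hvB n
    refine ⟨max (C n) C₂, fun t ht => ?_⟩
    by_cases htT : t < T
    · simp only [if_pos htT]
      exact (hC n t ⟨ht.1, htT.le⟩).trans (ENNReal.coe_le_coe.2 (le_max_left _ _))
    · simp only [if_neg htT]
      have hTt : T ≤ t := not_lt.1 htT
      exact (hC₂ (t + -s) ⟨by linarith, by linarith [ht.2]⟩).trans
        (ENNReal.coe_le_coe.2 (le_max_right _ _))
  · simp only [if_pos hT]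
  · intro t ht
    simp only [if_pos ht.2]

/-! ## The alternative -/

/-- **The maximal solution in the Beale–Kato–Majda class (blow-up alternative), `ν ≥ 0`.** Let `u₀` be
smooth, divergence free, with all derivatives in `L²`. Then EITHER every closed slab `[0, T] × ℝ³`,
`T > 0`, carries a classical solution of the unforced system (viscosity `ν ≥ 0`; Euler for `ν = 0`) from
`u₀` with all `L²` Sobolev seminorms bounded on `[0, T]`, OR there are `T* > 0` and a classical solution
`(u, p)` on `[0, T*) × ℝ³` from `u₀`, in the class on every `[0, T'']`, `T'' < T*`, such that: the squared
`H³` size `Σ_{n ≤ 3} ∫‖Dⁿu(t)‖²` is unbounded on `[0, T*)`; `u` does not continue in the class past `T*`;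
`∫₀^{T*} sup_x |curl u| = ∞`; and no closed slab `[0, T]`, `T ≥ T*`, carries a classical solution from
`u₀` in the class. (Majda–Bertozzi 2002, §3.3: the maximal time of `H^m` existence is characterised by
`‖v(·,t)‖_m → ∞`, Thm. 3.6 / Beale–Kato–Majda 1984, Corollary: and by `∫₀^{T*}|ω|_∞ = ∞`.) See the
module docstring for the proof from the tree's local existence, uniqueness, restart, gluing and
continuation theorems. [cite: MajdaBertozzi2002, §3.3 before Thm. 3.6 and Thm. 3.6 (pp. 115–117), Cor. 3.2 (p. 112)] [cite: BealeKatoMajda1984, Thm. 1 and Corollary] -/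
theorem bkmClass_dichotomy (hν : 0 ≤ ν) (hu₀ : ContDiff ℝ ∞ u₀)
    (hdiv : VectorCalculus.IsDivFree u₀) (hH : ∀ n : ℕ, ∫⁻ x, ‖iteratedFDeriv ℝ n u₀ x‖ₑ ^ 2 < ⊤) :
    (∀ T : ℝ, 0 < T →
      ∃ (u : ℝ → EuclideanSpace ℝ (Fin 3) → EuclideanSpace ℝ (Fin 3))
        (p : ℝ → EuclideanSpace ℝ (Fin 3) → ℝ),
        IsClassicalNSSolutionOn (Icc 0 T) ν 0 u p ∧ u 0 = u₀ ∧ HasBoundedSobolevNormsOn (Icc 0 T) u) ∨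
    ∃ Ts : ℝ, 0 < Ts ∧
      ∃ (u : ℝ → EuclideanSpace ℝ (Fin 3) → EuclideanSpace ℝ (Fin 3))
        (p : ℝ → EuclideanSpace ℝ (Fin 3) → ℝ),
        IsClassicalNSSolutionOn (Ico 0 Ts) ν 0 u p ∧ u 0 = u₀ ∧
        (∀ T'' < Ts, HasBoundedSobolevNormsOn (Icc 0 T'') u) ∧
        (¬ ∃ A : ℝ≥0, ∀ t ∈ Ico 0 Ts,
          (∑ n ∈ Finset.range 4, ∫⁻ x, ‖iteratedFDeriv ℝ n (u t) x‖ₑ ^ 2) ≤ (A : ℝ≥0∞)) ∧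
        ¬ HasSobolevExtensionPast ν u Ts ∧
        (∫⁻ t in Ioo 0 Ts, ⨆ x, ‖curl (u t) x‖ₑ) = ⊤ ∧
        ∀ T : ℝ, Ts ≤ T →
          ∀ (w : ℝ → EuclideanSpace ℝ (Fin 3) → EuclideanSpace ℝ (Fin 3))
            (q : ℝ → EuclideanSpace ℝ (Fin 3) → ℝ),
            IsClassicalNSSolutionOn (Icc 0 T) ν 0 w q → w 0 = u₀ →
              ¬ HasBoundedSobolevNormsOn (Icc 0 T) w := by
  classical
  by_cases hall : ∀ T : ℝ, 0 < T →
      ∃ (u : ℝ → EuclideanSpace ℝ (Fin 3) → EuclideanSpace ℝ (Fin 3))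
        (p : ℝ → EuclideanSpace ℝ (Fin 3) → ℝ),
        IsClassicalNSSolutionOn (Icc 0 T) ν 0 u p ∧ u 0 = u₀ ∧ HasBoundedSobolevNormsOn (Icc 0 T) u
  · exact Or.inl hall
  right
  push Not at hall
  obtain ⟨T₁, hT₁, hnot₁⟩ := hall
  -- the set of good horizons
  set S : Set ℝ := {T | 0 < T ∧
      ∃ (u : ℝ → EuclideanSpace ℝ (Fin 3) → EuclideanSpace ℝ (Fin 3))
        (p : ℝ → EuclideanSpace ℝ (Fin 3) → ℝ),
        IsClassicalNSSolutionOn (Icc 0 T) ν 0 u p ∧ u 0 = u₀ ∧ HasBoundedSobolevNormsOn (Icc 0 T) u}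
    with hSdef
  -- restriction: `S` is an initial segment of `(0, ∞)`
  have hmono : ∀ {T T' : ℝ}, 0 < T' → T' ≤ T → T ∈ S → T' ∈ S := by
    rintro T T' hT' hle ⟨-, u, p, hcl, h0, hB⟩
    exact ⟨hT', u, p, hcl.mono (Icc_subset_Icc_right hle) (uniqueDiffOn_Icc hT'), h0,
      hB.mono (Icc_subset_Icc_right hle)⟩
  -- openness to the right: restart from the closed slab
  have hopen : ∀ {T : ℝ}, T ∈ S → ∃ T', T < T' ∧ T' ∈ S := by
    rintro T ⟨hT, u, p, hcl, h0, hB⟩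
    obtain ⟨T', hTT', u', p', hcl', hB', h0', -⟩ := exists_bkmClass_Icc_extension hν hT hcl hB
    exact ⟨T', hTT', hT.trans hTT', u', p', hcl', h0'.trans h0, hB'⟩
  have hT₁S : T₁ ∉ S := fun h => by
    obtain ⟨-, u, p, hcl, h0, hB⟩ := h
    exact hnot₁ u p hcl h0 hB
  have hbdd : BddAbove S := ⟨T₁, fun T hT => le_of_not_gt fun h => hT₁S (hmono hT₁ h.le hT)⟩
  -- local existence: `S` is nonempty
  have hfin : (∑ n ∈ Finset.range 4, ∫⁻ x, ‖iteratedFDeriv ℝ n u₀ x‖ₑ ^ 2) < ⊤ :=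
    ENNReal.sum_lt_top.2 fun n _ => hH n
  obtain ⟨T₀, hT₀, hLT₀⟩ := MajdaBertozzi2002_localExistenceH3_holds hν
    (∑ n ∈ Finset.range 4, ∫⁻ x, ‖iteratedFDeriv ℝ n u₀ x‖ₑ ^ 2).toNNReal
  obtain ⟨V₀, P₀, hV₀, hV₀0, hV₀B⟩ := hLT₀ hu₀ hdiv hH (ENNReal.coe_toNNReal hfin.ne).ge
  have hT₀S : T₀ ∈ S := ⟨hT₀, V₀, P₀, hV₀, hV₀0, hV₀B⟩
  have hne : S.Nonempty := ⟨T₀, hT₀S⟩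
  -- the maximal time
  set Ts : ℝ := sSup S with hTsdef
  have hT₀le : T₀ ≤ Ts := le_csSup hbdd hT₀S
  have hTs : 0 < Ts := hT₀.trans_le hT₀le
  have hbelow : ∀ T', 0 < T' → T' < Ts → T' ∈ S := by
    intro T' hT' hlt
    obtain ⟨T, hT, hT'T⟩ := exists_lt_of_lt_csSup hne hlt
    exact hmono hT' hT'T.le hT
  have habove : ∀ T, Ts ≤ T → T ∉ S := by
    intro T hT hTS
    obtain ⟨T', hTT', hT'S⟩ := hopen hTS
    exact (le_csSup hbdd hT'S).not_gt (hT.trans_lt hTT')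
  -- the horizons `b n = T* (n+1)/(n+2) ↑ T*` and class solutions on their closed slabs
  set b : ℕ → ℝ := fun n => Ts * ((n : ℝ) + 1) / ((n : ℝ) + 2) with hbdef
  have hbpos : ∀ n, 0 < b n := fun n => by rw [hbdef]; positivity
  have hblt : ∀ n, b n < Ts := fun n => by
    have h2 : (0 : ℝ) < (n : ℝ) + 2 := by positivity
    rw [hbdef, div_lt_iff₀ h2]
    nlinarith
  have hbS : ∀ n, b n ∈ S := fun n => hbelow (b n) (hbpos n) (hblt n)
  choose _hbpos' V P hV hV0 hVB using hbS
  have hb : ∀ t, t < Ts → ∃ n : ℕ, t < b n := by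
    intro t ht
    have hpos : 0 < Ts - t := sub_pos.2 ht
    obtain ⟨n, hn⟩ := exists_nat_gt (Ts / (Ts - t))
    refine ⟨n, ?_⟩
    have h1 : Ts < (n : ℝ) * (Ts - t) := (div_lt_iff₀ hpos).1 hn
    have h2 : (0 : ℝ) < (n : ℝ) + 2 := by positivity
    rw [hbdef, lt_div_iff₀ h2]
    nlinarith [hTs, (Nat.cast_nonneg n : (0 : ℝ) ≤ n)]
  -- two class solutions on closed slabs agree at every common time (Majda–Bertozzi, Cor. 3.1)
  have huniq : ∀ {T₁' T₂' : ℝ} {w₁ w₂ : ℝ → EuclideanSpace ℝ (Fin 3) → EuclideanSpace ℝ (Fin 3)}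
      {r₁ r₂ : ℝ → EuclideanSpace ℝ (Fin 3) → ℝ},
      IsClassicalNSSolutionOn (Icc 0 T₁') ν 0 w₁ r₁ → w₁ 0 = u₀ → HasBoundedSobolevNormsOn (Icc 0 T₁') w₁ →
      IsClassicalNSSolutionOn (Icc 0 T₂') ν 0 w₂ r₂ → w₂ 0 = u₀ → HasBoundedSobolevNormsOn (Icc 0 T₂') w₂ →
      ∀ t ∈ Icc (0 : ℝ) T₁', t ≤ T₂' → w₁ t = w₂ t := by
    intro T₁' T₂' w₁ w₂ r₁ r₂ hw₁ hw₁0 hB₁ hw₂ hw₂0 hB₂ t ht htT₂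
    rcases ht.1.eq_or_lt with h0 | htpos
    · rw [← h0, hw₁0, hw₂0]
    set m : ℝ := min T₁' T₂' with hm
    have htm : t ∈ Icc 0 m := ⟨ht.1, le_min ht.2 htT₂⟩
    have hm0 : 0 < m := htpos.trans_le htm.2
    have hS₁ : Icc 0 m ⊆ Icc 0 T₁' := Icc_subset_Icc_right (min_le_left _ _)
    have hS₂ : Icc 0 m ⊆ Icc 0 T₂' := Icc_subset_Icc_right (min_le_right _ _)
    exact MajdaBertozzi2002_uniquenessSobolev_holds hν hm0 (hw₁.mono hS₁ (uniqueDiffOn_Icc hm0))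
      (hw₂.mono hS₂ (uniqueDiffOn_Icc hm0)) (hB₁.mono hS₁) (hB₂.mono hS₂) (hw₁0.trans hw₂0.symm) t htm
  have hagree : ∀ m n, ∀ t ∈ Ico (0 : ℝ) (min (b m) (b n)), V m t = V n t := by
    intro m n t ht
    exact huniq (hV m) (hV0 m) (hVB m) (hV n) (hV0 n) (hVB n) t
      ⟨ht.1, (ht.2.trans_le (min_le_left _ _)).le⟩ (ht.2.trans_le (min_le_right _ _)).le
  -- glue them on `[0, T*)`
  have hVIco : ∀ n, IsClassicalNSSolutionOn (Ico 0 (b n)) ν 0 (V n) (P n) := fun n =>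
    (hV n).mono Ico_subset_Icc_self (uniqueDiffOn_Ico 0 (b n))
  obtain ⟨v, q, hv, hvn⟩ := IsClassicalNSSolutionOn.exists_glue_Ico_right (a := 0) (β := Ts)
    (fun n => (hblt n).le) hb hVIco hagree
  have hv0 : v 0 = u₀ := (hvn 0 0 ⟨le_rfl, hbpos 0⟩).trans (hV0 0)
  -- `v` is in the class on every compact sub-slab
  have hreg : ∀ T'' < Ts, HasBoundedSobolevNormsOn (Icc 0 T'') v := by
    intro T'' hT''
    obtain ⟨n, hn⟩ := hb T'' hT''
    intro k
    obtain ⟨Ck, hCk⟩ := hVB n k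
    refine ⟨Ck, fun t ht => ?_⟩
    rw [hvn n t ⟨ht.1, ht.2.trans_lt hn⟩]
    exact hCk t ⟨ht.1, (ht.2.trans_lt hn).le⟩
  -- no continuation in the class past `T*`: it would put `T*` into `S`
  have hmax : ¬ HasSobolevExtensionPast ν v Ts := by
    rintro ⟨T', hT', u', p', hcl', hB', hagr⟩
    have hcl'' : IsClassicalNSSolutionOn (Icc 0 Ts) ν 0 u' p' :=
      hcl'.mono (Icc_subset_Ico_right hT') (uniqueDiffOn_Icc hTs)
    have hu'0 : u' 0 = u₀ := (hagr 0 ⟨le_rfl, hTs⟩).trans hv0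
    exact habove Ts le_rfl ⟨hTs, u', p', hcl'', hu'0, hB'⟩
  refine ⟨Ts, hTs, v, q, hv, hv0, hreg, ?_, hmax, ?_, fun T hTsT w r hw hw0 hwB => ?_⟩
  · -- the squared `H³` size is unbounded on `[0, T*)` (Majda–Bertozzi Cor. 3.2, discharged)
    intro hA
    exact hmax ((hasSobolevExtensionPast_iff_exists_H3_bound hν hTs hv hreg).2 hA)
  · -- the BKM integral is infinite (Beale–Kato–Majda Thm. 1, discharged)
    exact lintegral_iSup_curl_eq_top_of_not_hasSobolevExtensionPast_holds hν hTs hv hreg hmax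
  · -- NO class solution on a closed slab `[0, T]`, `T ≥ T*`
    exact habove T hTsT ⟨hTs.trans_le hTsT, w, r, hw, hw0, hwB⟩

/-- **Global form of the alternative in the Beale–Kato–Majda class, `ν ≥ 0`.** For a smooth
divergence-free datum with all derivatives in `L²`, EITHER there is a classical solution of the unforced
system on `[0, ∞) × ℝ³` from `u₀` with all `L²` Sobolev seminorms bounded on every `[0, T]` (pressure
normalised by `p(t, 0) = 0`), OR the maximal-time branch of `bkmClass_dichotomy` holds. The first branch
is patched from the closed slabs by the tree's generic `IsClassicalNSSolutionOn.exists_Ici_of_forall_Icc_of_unique`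
(uniqueness across horizons = Majda–Bertozzi Cor. 3.1, `MajdaBertozzi2002_uniquenessSobolev_holds`).
[cite: MajdaBertozzi2002, Thm. 3.6 and §3.3 (pp. 115–117), Cor. 3.1 (p. 88), Cor. 3.2 (p. 112)] [cite: BealeKatoMajda1984, Thm. 1 and Corollary] -/
theorem exists_global_bkmClass_or_blowup (hν : 0 ≤ ν) (hu₀ : ContDiff ℝ ∞ u₀)
    (hdiv : VectorCalculus.IsDivFree u₀) (hH : ∀ n : ℕ, ∫⁻ x, ‖iteratedFDeriv ℝ n u₀ x‖ₑ ^ 2 < ⊤) :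
    (∃ (u : ℝ → EuclideanSpace ℝ (Fin 3) → EuclideanSpace ℝ (Fin 3))
        (p : ℝ → EuclideanSpace ℝ (Fin 3) → ℝ),
        IsClassicalNSSolutionOn (Ici 0) ν 0 u p ∧ u 0 = u₀ ∧
          (∀ T : ℝ, HasBoundedSobolevNormsOn (Icc 0 T) u) ∧ ∀ t, p t 0 = 0) ∨
    ∃ Ts : ℝ, 0 < Ts ∧
      ∃ (u : ℝ → EuclideanSpace ℝ (Fin 3) → EuclideanSpace ℝ (Fin 3))
        (p : ℝ → EuclideanSpace ℝ (Fin 3) → ℝ),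
        IsClassicalNSSolutionOn (Ico 0 Ts) ν 0 u p ∧ u 0 = u₀ ∧
        (∀ T'' < Ts, HasBoundedSobolevNormsOn (Icc 0 T'') u) ∧
        (¬ ∃ A : ℝ≥0, ∀ t ∈ Ico 0 Ts,
          (∑ n ∈ Finset.range 4, ∫⁻ x, ‖iteratedFDeriv ℝ n (u t) x‖ₑ ^ 2) ≤ (A : ℝ≥0∞)) ∧
        ¬ HasSobolevExtensionPast ν u Ts ∧
        (∫⁻ t in Ioo 0 Ts, ⨆ x, ‖curl (u t) x‖ₑ) = ⊤ ∧
        ∀ T : ℝ, Ts ≤ T →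
          ∀ (w : ℝ → EuclideanSpace ℝ (Fin 3) → EuclideanSpace ℝ (Fin 3))
            (q : ℝ → EuclideanSpace ℝ (Fin 3) → ℝ),
            IsClassicalNSSolutionOn (Icc 0 T) ν 0 w q → w 0 = u₀ →
              ¬ HasBoundedSobolevNormsOn (Icc 0 T) w := by
  rcases bkmClass_dichotomy hν hu₀ hdiv hH with hall | hblow
  · left
    -- the class `Q` of the generic patching lemma
    obtain ⟨u, p, hu, hu0, hp0, hpiece⟩ :=
      IsClassicalNSSolutionOn.exists_Ici_of_forall_Icc_of_unique (ν := ν) (f := 0) (u₀ := u₀)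
        (fun T U P => IsClassicalNSSolutionOn (Icc 0 T) ν 0 U P ∧ U 0 = u₀ ∧
          HasBoundedSobolevNormsOn (Icc 0 T) U)
        (fun T U P h => ⟨h.1, h.2.1⟩) hall
        (fun T₁ T₂ U₁ P₁ U₂ P₂ h₁ h₂ t ht htT₂ => by
          rcases ht.1.eq_or_lt with h0 | htpos
          · rw [← h0, h₁.2.1, h₂.2.1]
          set m : ℝ := min T₁ T₂ with hm
          have htm : t ∈ Icc 0 m := ⟨ht.1, le_min ht.2 htT₂⟩
          have hm0 : 0 < m := htpos.trans_le htm.2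
          have hS₁ : Icc 0 m ⊆ Icc 0 T₁ := Icc_subset_Icc_right (min_le_left _ _)
          have hS₂ : Icc 0 m ⊆ Icc 0 T₂ := Icc_subset_Icc_right (min_le_right _ _)
          exact MajdaBertozzi2002_uniquenessSobolev_holds hν hm0 (h₁.1.mono hS₁ (uniqueDiffOn_Icc hm0))
            (h₂.1.mono hS₂ (uniqueDiffOn_Icc hm0)) (h₁.2.2.mono hS₁) (h₂.2.2.mono hS₂)
            (h₁.2.1.trans h₂.2.1.symm) t htm)
    refine ⟨u, p, hu, hu0, fun T => ?_, hp0⟩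
    -- every finite piece of the patched solution is one of the slab solutions
    have hT1 : 0 < max T 1 := lt_max_of_lt_right one_pos
    obtain ⟨T', U, P, hTT', ⟨-, -, hUB⟩, huU, -⟩ := hpiece (max T 1) hT1
    intro n
    obtain ⟨Cn, hCn⟩ := hUB n
    refine ⟨Cn, fun t ht => ?_⟩
    have ht' : t ∈ Icc 0 (max T 1) := ⟨ht.1, ht.2.trans (le_max_left _ _)⟩
    rw [huU t ht']
    exact hCn t ⟨ht.1, ht'.2.trans hTT'⟩
  · exact Or.inr hblow

end Literature.Analysis.FluidPDE

end

-- WHAT THIS IS NOT: not a claim about NS regularity or blow-up; not a claim about any author beyond the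
-- typed locator.
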